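import Mathlib
import HarnessLib
import Literature.MathematicalPhysics.KineticTheory.HardSphereEulerProofs
import Summits.AtomisticToContinuum.HydrodynamicLimit.Theses.OneFlightGossipEngine
import Summits.AtomisticToContinuum.HydrodynamicLimit.Theorems.OneFlightGossipEngineKineticCurrentsWindowLDUniformWindowRenyiOfTransportPrelim
import Summits.AtomisticToContinuum.HydrodynamicLimit.Theorems.OneFlightGossipEngineKineticCurrentsLDAlongFamiliesWindowRenyiOfTransport

/-!
# Rényi quasi-invariance along an ISOTHERMAL profile family over a kinetic window —
# stub `stub_windowRenyiFamily_isothermal` of line `Sketch`, crux `KineticCurrentsLDAlongFamilies`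
# (stmt-AtomisticToContinuum-16659)

Route `OneFlightGossipEngine`, sub-problem `HydrodynamicLimit`. A TRUE SPECIAL CASE of the registered
open stub S2 `stub_windowRenyiFamily` of `Cruxes/KineticCurrentsLDAlongFamilies/Lines/Sketch.lean`: its
body for profile families that are constant in `x` in drift and temperature (`θ₀ s x = θ s`,
`u₀ s x = u s`, ARBITRARY jointly continuous activity `a s x > 0`), with ONE threshold `N₀` serving
every `s ∈ [0, t₁]` — the family version of the landed pointwise isothermal case
`KineticCurrentsWindowLDUniformSigmaUniform.stub_windowRenyi_isothermal` (crux stmt-14662), for EVERY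
order `p > 1` (`windowRenyiFamily_isothermal_allOrders`) and in the registered `∃ p > 1` shape
(`stub_windowRenyiFamily_isothermal`, `p = 2`). A tightness anchor for the family crux.

Proof (the pointwise one with `s` carried). With constant `u s, θ s` the Maxwellian factor of `ψ_s`
is conserved along good orbits (energy and momentum,
`BoltzmannGreenKuboOrthMomentum.tensorPow_localGibbsProfile_const_flow`), so for good `z` and
`w = Φ_{-r} z`, `ψ_s(w) = ψ_s(z)·exp Σᵢ (log a_s(xᵢ(w)) − log a_s(xᵢ(z)))`; the integrand is
`ψ_s(z)·exp(p S)` a.e. ONE quadratic log-modulus `log a_s x − log a_s y ≤ δ/2 + C dist(y,x)²` serves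
all `s ∈ [0,t₁]` (Heine–Cantor on the compact `[0,t₁] × 𝕋³`, `wrf_sub_le_quad_family` of the sibling
module `…LDAlongFamiliesWindowRenyiOfTransport`), the displacement–energy bound gives
`p S ≤ pδ(N+1)/2 + 2pC r² E(z)`, and the Gaussian energy moment of `λ_s` is
`≤ (e^{γU²}(1−2γΘ)^{-3/2})^{N+1} ≤ e^{pδ(N+1)/2}` with the family bounds `θ ≤ Θ`, `‖u‖ ≤ U` on
`[0,t₁]`, once `4pC r² ≤ γ`, i.e. for `N ≥ N₀(τ, p, C, γ)` — uniform in `s`.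
-/

noncomputable section

open MeasureTheory Set Filter
open scoped ENNReal Topology

namespace Summit.AtomisticToContinuum.HydrodynamicLimit.Theorems.KineticCurrentsLDAlongFamiliesSketch

open Literature.Analysis.FluidPDE (HardSphereFlow Config localMaxwellian canonicalDensity liouville
  hardSphereDomain tensorPow)
open Literature.MathematicalPhysics.KineticTheory (T3 V3 hsDiameter localGibbsLaw localGibbsMeasure
  localGibbsProfile)
open Literature.Analysis.FluidPDE Literature.MathematicalPhysics.KineticTheory
open Summit.AtomisticToContinuum.HydrodynamicLimit.Theorems.KineticCurrentsWindowLDUniformLocalGibbs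
  (wre_sum_ratio_le wre_exists_gamma wre_exists_N0 wre_canonicalDensity_pos_of_mem)

/-! ### Family statics -/

/-- A continuous real function is bounded above on `[0, t₁]` by a positive constant. [folklore] -/
theorem wri_exists_forall_le_Icc {f : ℝ → ℝ} (hf : Continuous f) (t₁ : ℝ) :
    ∃ B : ℝ, 0 < B ∧ ∀ s ∈ Icc 0 t₁, f s ≤ B := by
  obtain ⟨C, hC⟩ := isCompact_Icc.exists_bound_of_continuousOn hf.continuousOn
  refine ⟨max C 1, zero_lt_one.trans_le (le_max_right _ _), fun s hs => ?_⟩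
  have h := hC s hs
  rw [Real.norm_eq_abs] at h
  exact ((le_abs_self _).trans h).trans (le_max_left _ _)

/-! ### The isothermal cocycle (pointwise in the parameter) -/

/-- The activity factors out of the tensor power of a local Gibbs profile:
`∏ᵢ a(xᵢ) M(vᵢ) = exp(Σᵢ log a(xᵢ)) · ∏ᵢ M(vᵢ)` for `a > 0`. [folklore] -/
-- adapted from OneFlightGossipEngineKineticCurrentsWindowLDUniformWindowRenyiIsothermal.lean
theorem wri_tensorPow_eq_exp_mul {a : T3 → ℝ} (ha0 : ∀ x, 0 < a x)
    (u : T3 → V3) (θ : T3 → ℝ) {n : ℕ} (z : Config n (Fin 3) T3) :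
    tensorPow n (localGibbsProfile a u θ) z =
      Real.exp (∑ i, Real.log (a (z i).1)) * tensorPow n (localGibbsProfile (fun _ => 1) u θ) z := by
  simp only [tensorPow, localGibbsProfile, one_mul]
  rw [Real.exp_sum, ← Finset.prod_mul_distrib]
  exact Finset.prod_congr rfl fun i _ => by rw [Real.exp_log (ha0 _)]

/-- **Cocycle of an isothermal local Gibbs density along a good orbit.** With constant drift and
temperature the Maxwellian factor is conserved (energy and momentum), so
`ψ(z) = ψ(Φ_t z) · exp Σᵢ (log a(xᵢ(0)) − log a(xᵢ(t)))`. [folklore] -/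
-- adapted from OneFlightGossipEngineKineticCurrentsWindowLDUniformWindowRenyiIsothermal.lean
theorem wri_isothermal_cocycle {σ : ℝ} {a : T3 → ℝ} (ha0 : ∀ x, 0 < a x) (θ : ℝ) (u : V3) {N : ℕ}
    (Φ : HardSphereFlow (Torus.geometry (Fin 3)) (hsDiameter σ N) (N + 1))
    {z : Config (N + 1) (Fin 3) T3} (hz : z ∈ Φ.good) (t : ℝ) :
    canonicalDensity (Torus.geometry (Fin 3)) (hsDiameter σ N) (N + 1)
        (localGibbsProfile a (fun _ => u) (fun _ => θ)) z =
      canonicalDensity (Torus.geometry (Fin 3)) (hsDiameter σ N) (N + 1)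
          (localGibbsProfile a (fun _ => u) (fun _ => θ)) (Φ.flow t z) *
        Real.exp (∑ i, (Real.log (a (z i).1) - Real.log (a (Φ.flow t z i).1))) := by
  simp only [canonicalDensity]
  rw [indicator_of_mem (Φ.good_subset hz), indicator_of_mem (Φ.good_subset (Φ.mapsTo_good t hz)),
    wri_tensorPow_eq_exp_mul ha0, wri_tensorPow_eq_exp_mul ha0,
    BoltzmannGreenKuboOrthMomentum.tensorPow_localGibbsProfile_const_flow 1 θ u Φ hz t,
    Finset.sum_sub_distrib, Real.exp_sub, mul_div_assoc', eq_div_iff (Real.exp_pos _).ne']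
  ring

/-! ### The isothermal family case, every order -/

/-- **Rényi quasi-invariance along an isothermal profile family, every order `p > 1`.** For a
jointly continuous activity family `a > 0` on `ℝ × 𝕋³`, continuous temperature and drift families
`θ > 0`, `u` (constant in `x`), `0 < σ ≤ 1/2`, every `p > 1`, `τ, δ > 0` and every flow family there
is ONE `N₀` such that for `N ≥ N₀`, every `s ∈ [0, t₁]` and every `r` in the kinetic window
`[0, τ(N+1)^{-1/3}]`: `∫ (ψ_s ∘ Φ_{-r})^p ψ_s^{1-p} dL ≤ e^{p δ (N+1)}`. The Maxwellian factor of
`ψ_s` is conserved, the activity cocycle is paid by one log-modulus on `[0,t₁] × 𝕋³` and the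
conserved energy over a vanishing window, the Gaussian energy moments by the family bounds of
`θ, ‖u‖` on `[0, t₁]`. [folklore] -/
theorem windowRenyiFamily_isothermal_allOrders :
    ∀ (t₁ : ℝ) (a : ℝ → T3 → ℝ) (θ : ℝ → ℝ) (u : ℝ → V3),
    Continuous (Function.uncurry a) → Continuous θ → Continuous u →
    (∀ s x, 0 < a s x) → (∀ s, 0 < θ s) →
    ∀ σ : ℝ, 0 < σ → σ ≤ 1 / 2 →
    ∀ p : ℝ, 1 < p → ∀ τ : ℝ, 0 < τ → ∀ δ : ℝ, 0 < δ →
    ∀ Φ : (N : ℕ) →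
      HardSphereFlow (Literature.Analysis.FluidPDE.Torus.geometry (Fin 3)) (hsDiameter σ N) (N + 1),
    ∃ N₀ : ℕ, ∀ N : ℕ, N₀ ≤ N → ∀ s ∈ Icc 0 t₁,
    ∀ r ∈ Icc (0 : ℝ) (τ * ((N : ℝ) + 1) ^ (-(1 / 3 : ℝ))),
      ∫⁻ z, ENNReal.ofReal (canonicalDensity (Literature.Analysis.FluidPDE.Torus.geometry (Fin 3))
            (hsDiameter σ N) (N + 1) (localGibbsProfile (a s) (fun _ => u s) (fun _ => θ s))
            ((Φ N).flow (-r) z)) ^ p *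
          ENNReal.ofReal (canonicalDensity (Literature.Analysis.FluidPDE.Torus.geometry (Fin 3))
            (hsDiameter σ N) (N + 1) (localGibbsProfile (a s) (fun _ => u s) (fun _ => θ s)) z) ^
            (1 - p)
        ∂(liouville (Literature.Analysis.FluidPDE.Torus.geometry (Fin 3)) (N + 1) (hsDiameter σ N)) ≤
      ENNReal.ofReal (Real.exp (p * (δ * ((N : ℝ) + 1)))) := by
  intro t₁ a θ u ha hθc huc ha0 hθ0 σ _hσ hσ2 p hp τ _hτ δ hδ Φ
  have hp0 : 0 < p := one_pos.trans hp
  -- family statics: ONE log-modulus, the bounds `Θ, U` on `[0,t₁]`, the exponent `γ`, and `N₀`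
  have hlogc : Continuous (Function.uncurry fun s x => Real.log (a s x)) :=
    ha.log fun q => (ha0 q.1 q.2).ne'
  obtain ⟨C, hC0, hC⟩ := wrf_sub_le_quad_family hlogc t₁ (half_pos hδ)
  obtain ⟨Θ, hΘ0, hΘ⟩ := wri_exists_forall_le_Icc hθc t₁
  obtain ⟨U, _, hU⟩ := wri_exists_forall_le_Icc (f := fun s => ‖u s‖) huc.norm t₁
  have hδ' : 0 < p * δ / 2 := by positivity
  obtain ⟨γ, hγ0, hγΘ, hK⟩ := wre_exists_gamma hΘ0 hδ' U
  obtain ⟨N₀, hN₀⟩ := wre_exists_N0 τ (p * C) hγ0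
  refine ⟨N₀, fun N hN s hs r hr => ?_⟩
  have has : Continuous (a s) := ha.uncurry_left s
  -- the Liouville measure, the density `ψ_s`, the Gaussian weight `Q`
  set cN : ℝ≥0∞ := ENNReal.ofReal (Real.exp (p * δ / 2 * ((N : ℝ) + 1))) with hcN
  set L := liouville (Torus.geometry (Fin 3)) (N + 1) (hsDiameter σ N) with hL
  set ψ : Config (N + 1) (Fin 3) T3 → ℝ≥0∞ := fun z => ENNReal.ofReal
    (canonicalDensity (Torus.geometry (Fin 3)) (hsDiameter σ N) (N + 1)
      (localGibbsProfile (a s) (fun _ => u s) (fun _ => θ s)) z) with hψ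
  have hlaw : localGibbsLaw σ (a s) (fun _ => u s) (fun _ => θ s) N (Φ N) = L.withDensity ψ := by
    simp only [localGibbsLaw, particleLaw_eq, hL, hψ]
  have hψm : Measurable ψ :=
    (measurable_canonicalDensity (hsDiameter σ N) (N + 1)
      (measurable_localGibbsProfile has continuous_const continuous_const)).ennreal_ofReal
  have hEm : Measurable fun z : Config (N + 1) (Fin 3) T3 => configEnergy z := by
    unfold configEnergy
    exact measurable_const.mul (Finset.measurable_sum _ fun i _ =>
      ((measurable_pi_apply i).snd.norm.pow_const 2))
  set Q : Config (N + 1) (Fin 3) T3 → ℝ≥0∞ := fun w =>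
    ENNReal.ofReal (Real.exp (γ * configEnergy w)) with hQ
  have hQm : Measurable Q := (Real.measurable_exp.comp (hEm.const_mul γ)).ennreal_ofReal
  have hψQm : Measurable fun w => ψ w * Q w := hψm.mul hQm
  -- Step 1: cocycle, cancellation of `ψ^{p} ψ^{1-p}` on the good set, energy bound of the cocycle
  have hpt : ∀ᵐ z ∂L, ψ ((Φ N).flow (-r) z) ^ p * ψ z ^ (1 - p) ≤ ψ z * (cN * Q z) := by
    filter_upwards [(Φ N).ae_mem_good] with z hz
    have hw : (Φ N).flow (-r) z ∈ (Φ N).good := (Φ N).mapsTo_good (-r) hz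
    have hzw : (Φ N).flow r ((Φ N).flow (-r) z) = z := by
      have h := (Φ N).flow_neg_flow (-r) hz
      rwa [neg_neg] at h
    have hcoc := wri_isothermal_cocycle (ha0 s) (θ s) (u s) (Φ N) hw r
    have hSz := wre_sum_ratio_le (Φ N) hw hC0 (hC s hs) hr.1
    rw [hzw] at hcoc hSz
    rw [(Φ N).configEnergy_flow hz (-r)] at hSz
    push_cast at hSz
    have hA := wre_canonicalDensity_pos_of_mem (σ := σ) (u₀ := fun _ => u s) has continuous_const
      continuous_const (ha0 s) (fun _ => hθ0 s) hσ2 ((Φ N).good_subset hz)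
    have hA0 : ψ z ≠ 0 := (ENNReal.ofReal_pos.2 hA).ne'
    simp only [hψ, hQ, hcN] at hA0 ⊢
    rw [hcoc, ENNReal.ofReal_mul hA.le, ENNReal.mul_rpow_of_nonneg _ _ hp0.le, mul_right_comm,
      ← ENNReal.rpow_add _ _ hA0 ENNReal.ofReal_ne_top, show p + (1 - p) = 1 by ring,
      ENNReal.rpow_one, ENNReal.ofReal_rpow_of_nonneg (Real.exp_nonneg _) hp0.le, ← Real.exp_mul,
      ← ENNReal.ofReal_mul (Real.exp_nonneg _), ← Real.exp_add]
    refine mul_le_mul_right (ENNReal.ofReal_le_ofReal (Real.exp_le_exp.2 ?_)) _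
    have hE0 : 0 ≤ configEnergy z := by unfold configEnergy; positivity
    have hcr : p * C * (4 * r ^ 2) ≤ γ :=
      (mul_le_mul_of_nonneg_left (mul_le_mul_of_nonneg_left (pow_le_pow_left₀ hr.1 hr.2 2)
        (by norm_num)) (by positivity)).trans (hN₀ N hN).le
    have h1 := mul_le_mul_of_nonneg_left hSz hp0.le
    have h2 := mul_le_mul_of_nonneg_right hcr hE0
    have h3 : 0 ≤ p * C * r ^ 2 * configEnergy z := by positivity
    nlinarith [h1, h2, h3]
  -- Step 2: the Gaussian energy moment of the local Gibbs law `λ_s`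
  have hK0 : 0 ≤ Real.exp (γ * U ^ 2) * (1 - 2 * γ * Θ) ^ (-(3 : ℝ) / 2) :=
    mul_nonneg (Real.exp_nonneg _) (Real.rpow_nonneg (by linarith) _)
  have hKN : (Real.exp (γ * U ^ 2) * (1 - 2 * γ * Θ) ^ (-(3 : ℝ) / 2)) ^ (N + 1) ≤
      Real.exp (p * δ / 2 * ((N : ℝ) + 1)) := by
    refine (pow_le_pow_left₀ hK0 hK (N + 1)).trans_eq ?_
    rw [← Real.exp_nat_mul]
    congr 1
    push_cast
    ring
  calc ∫⁻ z, ψ ((Φ N).flow (-r) z) ^ p * ψ z ^ (1 - p) ∂L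
      ≤ ∫⁻ z, ψ z * (cN * Q z) ∂L := lintegral_mono_ae hpt
    _ = cN * ∫⁻ w, Q w ∂(localGibbsLaw σ (a s) (fun _ => u s) (fun _ => θ s) N (Φ N)) := by
        rw [hlaw, lintegral_withDensity_eq_lintegral_mul L hψm hQm]
        simp only [Pi.mul_apply]
        rw [← lintegral_const_mul cN hψQm]
        exact lintegral_congr fun w => by ring
    _ ≤ cN * ENNReal.ofReal
          ((Real.exp (γ * U ^ 2) * (1 - 2 * γ * Θ) ^ (-(3 : ℝ) / 2)) ^ (N + 1)) :=
        mul_le_mul_right (lintegral_exp_mul_configEnergy_localGibbsLaw_le has continuous_const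
          continuous_const (ha0 s) (fun _ => hθ0 s) hσ2 N (Φ N) (Θ := Θ) (U := U) hγ0.le
          (fun _ => hΘ s hs) (fun _ => hU s hs) hγΘ) _
    _ ≤ cN * cN := mul_le_mul_right (ENNReal.ofReal_le_ofReal hKN) _
    _ = ENNReal.ofReal (Real.exp (p * (δ * ((N : ℝ) + 1)))) := by
        rw [hcN, ← ENNReal.ofReal_mul (Real.exp_nonneg _), ← Real.exp_add]
        congr 2
        ring

/-! ### The registered shape -/

/-- **Rényi quasi-invariance along an isothermal profile family, registered shape (stub
`stub_windowRenyiFamily_isothermal`).** The `∃ p > 1` form (`p = 2`) of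
`windowRenyiFamily_isothermal_allOrders`: exactly the body of the registered open stub
`stub_windowRenyiFamily` of line `Sketch` at the constant-in-`x` profile families
`θ₀ s x = θ s`, `u₀ s x = u s` (arbitrary jointly continuous activity `a > 0`), with one order `p`
and one threshold `N₀` for all `s ∈ [0, t₁]`. [folklore] -/
theorem stub_windowRenyiFamily_isothermal :
    ∀ (t₁ : ℝ) (a : ℝ → T3 → ℝ) (θ : ℝ → ℝ) (u : ℝ → V3),
    Continuous (Function.uncurry a) → Continuous θ → Continuous u →
    (∀ s x, 0 < a s x) → (∀ s, 0 < θ s) →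
    ∀ σ : ℝ, 0 < σ → σ ≤ 1 / 2 →
    ∃ p : ℝ, 1 < p ∧ ∀ τ : ℝ, 0 < τ → ∀ δ : ℝ, 0 < δ →
    ∀ Φ : (N : ℕ) →
      HardSphereFlow (Literature.Analysis.FluidPDE.Torus.geometry (Fin 3)) (hsDiameter σ N) (N + 1),
    ∃ N₀ : ℕ, ∀ N : ℕ, N₀ ≤ N → ∀ s ∈ Icc 0 t₁,
    ∀ r ∈ Icc (0 : ℝ) (τ * ((N : ℝ) + 1) ^ (-(1 / 3 : ℝ))),
      ∫⁻ z, ENNReal.ofReal (canonicalDensity (Literature.Analysis.FluidPDE.Torus.geometry (Fin 3))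
            (hsDiameter σ N) (N + 1) (localGibbsProfile (a s) (fun _ => u s) (fun _ => θ s))
            ((Φ N).flow (-r) z)) ^ p *
          ENNReal.ofReal (canonicalDensity (Literature.Analysis.FluidPDE.Torus.geometry (Fin 3))
            (hsDiameter σ N) (N + 1) (localGibbsProfile (a s) (fun _ => u s) (fun _ => θ s)) z) ^
            (1 - p)
        ∂(liouville (Literature.Analysis.FluidPDE.Torus.geometry (Fin 3)) (N + 1) (hsDiameter σ N)) ≤
      ENNReal.ofReal (Real.exp (p * (δ * ((N : ℝ) + 1)))) :=
  fun t₁ a θ u ha hθc huc ha0 hθ0 σ hσ hσ2 =>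
    ⟨2, one_lt_two,
      windowRenyiFamily_isothermal_allOrders t₁ a θ u ha hθc huc ha0 hθ0 σ hσ hσ2 2 one_lt_two⟩

end Summit.AtomisticToContinuum.HydrodynamicLimit.Theorems.KineticCurrentsLDAlongFamiliesSketch

end
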